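import Literature.Barriers.CriticalPhenomena.TimarLemma42UniformQuasiTransitive
import Literature.Barriers.CriticalPhenomena.TimarGoodBox
import Literature.Barriers.CriticalPhenomena.TimarHeavySlabsQuasiTransitiveW
import HarnessLib

/-!
# Timár 2006, proof of Thm. 4.3 on quasi-transitive graphs: `G'(x)`, the boxes `B_x(i; r)`,
# "good", nice clusters, `q > 0` (with the toppability surgery), and the uniform choice of `i`
# and `r` — PROVED for a height system

Barrier catalogue `Literature/Barriers/CriticalPhenomena/`; the quasi-transitive twin of
`TimarGoodBox.lean` (TRANSITIVE graphs, weights `autWeight G o`, `Δ = minNbrWeight G o`), for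
the heights `h = η.height` of a height system `η : HeightSystem G o`
(`TimarHeightsQuasiTransitive.lean`) and `Δ = η.ratio`. Á. Timár, *Percolation on
nonunimodular transitive graphs*, Ann. Probab. 34 (2006) 2344–2364, proof of Thm. 4.3
(pp. 2354–2356): `G'(x)`, `B_x(i; r)`, side boundary, "good", nice, `F(x)`, `q > 0`, the choice
of `i` and `r`; see `TimarGoodBox.lean` for the quotations and the formal reading, which are
unchanged: the mate `x'` is a neighbour of height exactly `Δ h(x)` (a long edge of the height
system, which every vertex has, `HeightSystem.exists_adj_height_eq`).

Everything of `TimarGoodBox.lean` is re-proved here for heights word for word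
(`HeightSystem.lowSet`, `lowerGraph`, `boxSet`, `boxStepGraph`, `boxCluster`, `BoxSealed`,
`boxGood`, `boxEdges`, measurability, equivariance under automorphisms, `IsNice`, `niceEvent`,
`boxGood_of_nice`, `uppermostEvent`, `containedEvent`, `exists_depth_radius_boxGood_ge`), with
ONE exception, the step "`q > 0`": the printed proof (and `TimarGoodBox.lean`) moves an uppermost
vertex of a light cluster to the mate `o'` by an automorphism, which on a quasi-transitive graph
is only possible inside one orbit. The replacement (subsection *Toppability*) is a second
insertion/deletion surgery: from any vertex `z` descend the long-edge chain `N = R₀ + 1` steps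
(`R₀` a radius within which every vertex sees the orbit of a vertex `t₀` where the uppermost
event is positive), connect to a vertex `t` of that orbit within `R₀` steps — all heights met are
`≤ h(z)` and `h(t) ≤ Δ h(z) < h(z)` — and on the uppermost event at `t` close all edges at the
vertices of this walk before its first visit to `C(t)` and open the walk up to there: the new
cluster of `z` is these finitely many vertices together with `C(t)`, infinite, light, with `z`
uppermost (`surgery_mem_uppermostEvent`, `uppermostEvent_ne_zero_of_walk`,
`uppermostEvent_ne_zero_of_isQuasiTransitive`). This is the second ingredient (after the height
system itself) of the quasi-transitive extension that the printed sources leave to the reader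
(Hutchcroft 2016, §2; Tang 2019, §4: "can be easily adapted").

## References

* Á. Timár, Ann. Probab. 34 (2006) 2344–2364 (arXiv:math/0702875), proof of Thm. 4.3:
  `G'(x)`, `B_x(i; r)`, side boundary, "good", p. 2355 (nice, `F(x)`, `q > 0` "by insertion and
  deletion tolerance", the choice of `i` and `r`, "uniform choice"). [Timar2006]
* T. Hutchcroft, C. R. Math. Acad. Sci. Paris 354 (2016) 944–947, §2 (Timár's theorem in the
  quasi-transitive setting). [Hutchcroft2016]
* P. Tang, Ann. Probab. 47 (2019), §4 (quasi-transitive nonunimodular setting). [Tang2019]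
-/

noncomputable section

namespace Literature.Barriers.CriticalPhenomena

open _root_.MeasureTheory _root_.Filter Literature.Probability.Percolation
open scoped _root_.ENNReal _root_.Topology

variable {V : Type*}

namespace HeightSystem

/-! ### `G'(x)`: the lower graph with the long edge `{x, x'}` -/

section LowerGraph

variable {G : SimpleGraph V} [G.LocallyFinite] {o : V} (η : HeightSystem G o)

/-- "Level `ℓ_1` and below", seen from `x`: the vertices of weight `≤ Δ w(x)`.
[cite: Timar2006, §4 (proof of Thm. 4.3: the subgraph induced by ℓ_1 and the levels below)] -/
def lowSet (η : HeightSystem G o) (x : V) : Set V := {v | η.height v ≤ η.ratio * η.height x}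

/-- **Timár's `G'(x)`**: the steps of `G` inside `lowSet x` together with the long edge
`{x, x'}` ("the union of this subgraph and the long edge from `o` to `o'`", transported to `x`).
[cite: Timar2006, §4 (proof of Thm. 4.3: G'(o), G'(x))] -/
def lowerGraph (η : HeightSystem G o) (x x' : V) : SimpleGraph V where
  Adj u v := G.Adj u v ∧ ((u ∈ η.lowSet x ∧ v ∈ η.lowSet x) ∨ s(u, v) = s(x, x'))
  symm.symm _ _ h := ⟨h.1.symm, h.2.imp (fun h' => ⟨h'.2, h'.1⟩) fun h' => Sym2.eq_swap.trans h'⟩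
  loopless.irrefl _ h := h.1.ne rfl

omit [G.LocallyFinite] in
/-- Adjacency in `G'(x)`, unfolded. [folklore] -/
@[simp] theorem lowerGraph_adj {x x' u v : V} :
    (η.lowerGraph x x').Adj u v ↔
      G.Adj u v ∧ ((u ∈ η.lowSet x ∧ v ∈ η.lowSet x) ∨ s(u, v) = s(x, x')) :=
  Iff.rfl

omit [G.LocallyFinite] in
/-- `G'(x)` is a subgraph of `G`. [folklore] -/
theorem lowerGraph_le (x x' : V) : η.lowerGraph x x' ≤ G := fun _ _ h => h.1

/-- `x ∉ lowSet x`: `Δ h(x) < h(x)`. [folklore] -/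
theorem not_mem_lowSet_self (hconn : G.Connected) (x : V) : x ∉ η.lowSet x := by
  show ¬ η.height x ≤ η.ratio * η.height x
  rw [not_le]
  calc η.ratio * η.height x < 1 * η.height x := by
        exact ENNReal.mul_lt_mul_left (η.height_ne_zero hconn x)
          (η.height_ne_top hconn x) η.ratio_lt_one
    _ = η.height x := one_mul _

omit [G.LocallyFinite] in
/-- A step of `G'(x)` from a vertex which is `x` or low lands on `x` or a low vertex, provided
`x'` is low. [folklore] -/
theorem lowerGraph_adj_mem {x x' u v : V} (hx' : x' ∈ η.lowSet x)
    (h : (η.lowerGraph x x').Adj u v) : v = x ∨ v ∈ η.lowSet x := by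
  rcases h.2 with ⟨-, hv⟩ | he
  · exact Or.inr hv
  · rcases Sym2.eq_iff.1 he with ⟨-, rfl⟩ | ⟨-, rfl⟩
    · exact Or.inr hx'
    · exact Or.inl rfl

end LowerGraph

/-! ### The boxes `B_x(i; r)`, their open components, "sealed" and "good" -/

section Box

variable {G : SimpleGraph V} [G.LocallyFinite] {o : V} (η : HeightSystem G o)

/-- The vertex set of the box hanging from `x` down to the weight threshold `A`, within radius
`r`: `{v : A < w(v)} ∩ B(x, r)` (the part of `B_x(i; r) = B(x; r) ∩ G'(x) ∩ G(ℓ_{j+i}, ℓ_j]`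
that the step graph `boxStepGraph` can reach). [cite: Timar2006, §4 (proof of Thm. 4.3: B_x(i; r))] -/
def boxSet (η : HeightSystem G o) (x : V) (A : ℝ≥0∞) (r : ℕ) : Set V := {v | A < η.height v} ∩ ballSet G x r

/-- The step graph of the box: steps of `G'(x)` inside `boxSet`.
[cite: Timar2006, §4 (proof of Thm. 4.3: B_x(i; r))] -/
def boxStepGraph (η : HeightSystem G o) (x x' : V) (A : ℝ≥0∞) (r : ℕ) : SimpleGraph V :=
  withinGraph (η.lowerGraph x x') (η.boxSet x A r)

/-- "The open component of `x` in `B_x(i; r)`". [cite: Timar2006, §4 (proof of Thm. 4.3)] -/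
def boxCluster (η : HeightSystem G o) (x x' : V) (A : ℝ≥0∞) (r : ℕ) (ω : BondConfig V) : Set V :=
  openClusterIn (η.boxStepGraph x x' A r) ω x

/-- **Sealed** ("the side boundary of `B_x(i; r)` is disjoint from `C`", with open edges): every
open edge of `G` from a vertex `u ≠ x` of the component leads either into the box at a low vertex
(or back to `x`), or down to weight `≤ A`. [cite: Timar2006, §4 (proof of Thm. 4.3: side boundary disjoint from C)] -/
def BoxSealed (η : HeightSystem G o) (x x' : V) (A : ℝ≥0∞) (r : ℕ) (ω : BondConfig V) : Prop :=
  ∀ u ∈ η.boxCluster x x' A r ω, u ≠ x → ∀ v, G.Adj u v → s(u, v) ∈ ω →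
    (v ∈ η.boxSet x A r ∧ (v ∈ η.lowSet x ∨ v = x)) ∨ η.height v ≤ A

/-- **"Good"**: the open component of `x` in the box has at least `k` vertices in the bottom
window `(A, A Δ⁻¹]` and is sealed. [cite: Timar2006, §4 (proof of Thm. 4.3: definition of good)] -/
def boxGood (η : HeightSystem G o) (x x' : V) (A : ℝ≥0∞) (r k : ℕ) : Set (BondConfig V) :=
  {ω | (k : ℕ∞) ≤ (η.boxCluster x x' A r ω ∩ η.wwindow A).encard ∧ η.BoxSealed x x' A r ω}

/-- `x` lies in its box as soon as `A < w(x)`. [folklore] -/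
theorem mem_boxSet_self {x : V} {A : ℝ≥0∞} (hA : A < η.height x) (r : ℕ) :
    x ∈ η.boxSet x A r :=
  ⟨hA, mem_ballSet_self G x r⟩

/-- The component lies in the box (given `x` does). [folklore] -/
theorem boxCluster_subset_boxSet {x x' : V} {A : ℝ≥0∞} {r : ℕ} (hx : x ∈ η.boxSet x A r)
    (ω : BondConfig V) : η.boxCluster x x' A r ω ⊆ η.boxSet x A r :=
  openClusterIn_withinGraph_subset hx ω

/-- The component lies in the open cluster of `x`. [folklore] -/
theorem boxCluster_subset_openCluster (x x' : V) (A : ℝ≥0∞) (r : ℕ) (ω : BondConfig V) :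
    η.boxCluster x x' A r ω ⊆ openCluster ω x :=
  openClusterIn_subset_openCluster _ ω x

/-- Along a walk of the constrained open graph starting at `x` or at a low vertex, every vertex
is `x` or low (for `x'` low). [folklore] -/
theorem eq_or_mem_lowSet_of_walk {x x' : V} {A : ℝ≥0∞} {r : ℕ} (hx' : x' ∈ η.lowSet x)
    {ω : BondConfig V} :
    ∀ {a b : V} (_ : (openGraph ω ⊓ η.boxStepGraph x x' A r).Walk a b),
      (a = x ∨ a ∈ η.lowSet x) → (b = x ∨ b ∈ η.lowSet x)
  | _, _, .nil, h => h
  | _, _, .cons hadj q, _ => eq_or_mem_lowSet_of_walk hx' q (η.lowerGraph_adj_mem hx' hadj.2.1)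

/-- **A vertex of the component other than `x` is low** (for `x'` low): it is entered by a step of
`G'(x)`, i.e. inside `lowSet x` or along the long edge to `x'`. [cite: Timar2006, §4 (proof of Thm. 4.3: G'(x))] -/
theorem mem_lowSet_of_mem_boxCluster {x x' : V} {A : ℝ≥0∞} {r : ℕ} (hx' : x' ∈ η.lowSet x)
    {ω : BondConfig V} {u : V} (hu : u ∈ η.boxCluster x x' A r ω) (hne : u ≠ x) :
    u ∈ η.lowSet x := by
  rw [boxCluster, mem_openClusterIn_iff] at hu
  obtain ⟨p⟩ := hu
  exact (η.eq_or_mem_lowSet_of_walk hx' p (Or.inl rfl)).resolve_left hne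

/-- A vertex which is neither `x` nor low is not in the component of `x`'s box. [folklore] -/
theorem not_mem_boxCluster {x x' : V} {A : ℝ≥0∞} {r : ℕ} (hx' : x' ∈ η.lowSet x) {y : V}
    (hyx : y ≠ x) (hy : y ∉ η.lowSet x) (ω : BondConfig V) : y ∉ η.boxCluster x x' A r ω :=
  fun h => hy (η.mem_lowSet_of_mem_boxCluster hx' h hyx)

/-- Core of the disjointness argument: a constrained open walk of `y`'s box ending at `y` cannot
start at a vertex `≠ x` of a SEALED component of `x`'s box (same threshold `A`), when `y` is
neither `x` nor low for `x` and `x` is neither `y` nor low for `y`.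
[cite: Timar2006, §4 (proof of Thm. 4.3: "these components are disjoint unless x' = y'")] -/
theorem false_of_walk_of_sealed (hconn : G.Connected) {x x' y y' : V} {A : ℝ≥0∞} {r s : ℕ}
    (hx' : x' ∈ η.lowSet x) (hy' : y' ∈ η.lowSet y) (hxA : x ∈ η.boxSet x A r)
    (hyx : y ≠ x) (hy : y ∉ η.lowSet x) (hxy : x ≠ y) (hx : x ∉ η.lowSet y)
    {ω : BondConfig V} (hseal : η.BoxSealed x x' A r ω) :
    ∀ {c : V} (_ : (openGraph ω ⊓ η.boxStepGraph y y' A s).Walk c y),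
      c ∈ η.boxCluster x x' A r ω → c ≠ x → False
  | _, .nil, hc, hcx => η.not_mem_boxCluster hx' hyx hy ω hc
  | c, .cons (v := d) hadj q, hc, hcx => by
    have hopen : s(c, d) ∈ ω := ((openGraph_adj ω c d).1 hadj.1).1
    have hG : G.Adj c d := hadj.2.1.1
    have hdA : A < η.height d := hadj.2.2.2.1
    -- `d` lies on a walk to `y`, hence in the component of `y`'s box
    have hdy : d ∈ η.boxCluster y y' A s ω := by
      rw [boxCluster, mem_openClusterIn_iff]
      exact ⟨q.reverse⟩
    rcases hseal c hc hcx d hG hopen with ⟨hdbox, hdlow | hdx⟩ | hdle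
    · -- `d` is a low vertex of `x`'s box: the step is a step of `x`'s box graph, recurse
      have hclow : c ∈ η.lowSet x := η.mem_lowSet_of_mem_boxCluster hx' hc hcx
      have hd : d ∈ η.boxCluster x x' A r ω :=
        mem_openClusterIn_of_adj hc ⟨⟨hG, Or.inl ⟨hclow, hdlow⟩⟩,
          η.boxCluster_subset_boxSet hxA ω hc, hdbox⟩ hopen
      exact false_of_walk_of_sealed hconn hx' hy' hxA hyx hy hxy hx hseal q hd
        fun h => η.not_mem_lowSet_self hconn x (h ▸ hdlow)
    · -- `d = x` would put `x` into the component of `y`'s box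
      subst hdx
      exact η.not_mem_boxCluster hy' hxy hx ω hdy
    · exact absurd hdA (not_lt.2 hdle)

/-- **The components of two sealed boxes of one generation are disjoint** ("if the open
components of `x` in `B_x` and `y` in `B_y` are good, then these components are disjoint
[unless `x' = y'`]" — here without exception, `x'` not being exempted from the sealing): for
boxes with a common bottom threshold `A` hanging from `x ≠ y`, neither of which is low for the
other (e.g. both in one slab), sealedness of `x`'s component alone forces disjointness.
[cite: Timar2006, §4 (proof of Thm. 4.3: "these components are disjoint unless x' = y'")] -/
theorem boxCluster_disjoint_of_sealed (hconn : G.Connected) {x x' y y' : V} {A : ℝ≥0∞} {r s : ℕ}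
    (hx' : x' ∈ η.lowSet x) (hy' : y' ∈ η.lowSet y) (hxA : x ∈ η.boxSet x A r)
    (hxy : x ≠ y) (hy : y ∉ η.lowSet x) (hx : x ∉ η.lowSet y)
    {ω : BondConfig V} (hseal : η.BoxSealed x x' A r ω) :
    Disjoint (η.boxCluster x x' A r ω) (η.boxCluster y y' A s ω) := by
  rw [Set.disjoint_left]
  intro v hvx hvy
  have hvy' := hvy
  rw [boxCluster, mem_openClusterIn_iff] at hvy'
  obtain ⟨p⟩ := hvy'.symm
  refine η.false_of_walk_of_sealed hconn hx' hy' hxA hxy.symm hy hxy hx hseal p hvx ?_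
  rintro rfl
  exact η.not_mem_boxCluster hy' hxy hx ω hvy

/-! ### The edges a good box depends on -/

/-- The edges the event `η.boxGood x x' A r k` depends on: the edges of the box graph, and
the edges of `G` from a low vertex of the box to a vertex of weight `> A` that is not a low
vertex of the box or `x` (the possible open exits forbidden by sealedness).
[cite: Timar2006, §4 (proof of Thm. 4.3: the edge sets in B_x)] -/
def boxEdges (η : HeightSystem G o) (x x' : V) (A : ℝ≥0∞) (r : ℕ) :
    Set (Sym2 V) :=
  (η.boxStepGraph x x' A r).edgeSet ∪
    {e | ∃ u v : V, e = s(u, v) ∧ u ∈ η.boxSet x A r ∧ u ∈ η.lowSet x ∧ G.Adj u v ∧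
      A < η.height v ∧ ¬ (v ∈ η.boxSet x A r ∧ (v ∈ η.lowSet x ∨ v = x))}

/-- The component of the box only depends on the edges of the box graph. [folklore] -/
theorem boxCluster_eq_of_inter_eq {x x' : V} {A : ℝ≥0∞} {r : ℕ} {ω ω' : BondConfig V}
    (h : ω ∩ η.boxEdges x x' A r = ω' ∩ η.boxEdges x x' A r) :
    η.boxCluster x x' A r ω = η.boxCluster x x' A r ω' := by
  rw [boxCluster, boxCluster, ← openClusterIn_inter_edgeSet _ ω, ← openClusterIn_inter_edgeSet _ ω',
    inter_eq_inter_of_subset h Set.subset_union_left]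

/-- Sealedness transfers between configurations agreeing on `boxEdges`. [folklore] -/
theorem boxSealed_of_inter_eq {x x' : V} {A : ℝ≥0∞} {r : ℕ} (hx' : x' ∈ η.lowSet x)
    (hxA : x ∈ η.boxSet x A r) {ω ω' : BondConfig V}
    (h : ω ∩ η.boxEdges x x' A r = ω' ∩ η.boxEdges x x' A r)
    (hseal : η.BoxSealed x x' A r ω) : η.BoxSealed x x' A r ω' := by
  intro u hu hux v hG hopen'
  rw [← η.boxCluster_eq_of_inter_eq h] at hu
  by_cases hvA : η.height v ≤ A
  · exact Or.inr hvA
  by_cases hcond : v ∈ η.boxSet x A r ∧ (v ∈ η.lowSet x ∨ v = x)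
  · exact Or.inl hcond
  -- otherwise the edge is one of `boxEdges`, so it is open in `ω` too
  have he : s(u, v) ∈ η.boxEdges x x' A r :=
    Or.inr ⟨u, v, rfl, η.boxCluster_subset_boxSet hxA ω hu, η.mem_lowSet_of_mem_boxCluster hx' hu hux,
      hG, not_le.1 hvA, hcond⟩
  have hopen : s(u, v) ∈ ω := ((Set.ext_iff.1 h _).2 ⟨hopen', he⟩).1
  exact hseal u hu hux v hG hopen

/-- **The good event is determined by the edges `boxEdges`.** [cite: Timar2006, §4 (proof of Thm. 4.3: the edge sets in B_x)] -/
theorem determinedBy_boxGood {x x' : V} {A : ℝ≥0∞} {r : ℕ} (hx' : x' ∈ η.lowSet x)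
    (hxA : x ∈ η.boxSet x A r) (k : ℕ) :
    DeterminedBy (η.boxGood x x' A r k) (η.boxEdges x x' A r) := by
  rw [determinedBy_iff]
  intro ω ω' h
  simp only [boxGood, Set.mem_setOf_eq, η.boxCluster_eq_of_inter_eq h]
  exact and_congr_right fun _ =>
    ⟨η.boxSealed_of_inter_eq hx' hxA h, η.boxSealed_of_inter_eq hx' hxA h.symm⟩

/-- Every edge of `boxEdges` joins two vertices of `B(x, r+1)`. [folklore] -/
theorem boxEdges_subset (x x' : V) (A : ℝ≥0∞) (r : ℕ) :
    η.boxEdges x x' A r ⊆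
      (fun q : V × V => s(q.1, q.2)) '' (ballSet G x (r + 1) ×ˢ ballSet G x (r + 1)) := by
  have hr : ballSet G x r ⊆ ballSet G x (r + 1) := ballSet_mono x (Nat.le_succ r)
  rintro e (he | ⟨u, v, rfl, hu, -, hG, -, -⟩)
  · induction e using Sym2.ind with
    | h u v =>
      have hadj := (SimpleGraph.mem_edgeSet _).1 he
      exact ⟨(u, v), ⟨hr hadj.2.1.2, hr hadj.2.2.2⟩, rfl⟩
  · exact ⟨(u, v), ⟨hr hu.2, mem_ballSet_succ_of_adj hu.2 hG⟩, rfl⟩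

/-- `boxEdges` is finite. [folklore] -/
theorem boxEdges_finite (x x' : V) (A : ℝ≥0∞) (r : ℕ) : (η.boxEdges x x' A r).Finite :=
  (((ballSet_finite G x (r + 1)).prod (ballSet_finite G x (r + 1))).image _).subset
    (η.boxEdges_subset x x' A r)

/-- **Weights on the edges of `boxEdges`**: both endpoints have weight `> A`, and one endpoint is
low (weight `≤ Δ w(x)`), provided `x'` is low and `x` lies in its box. [cite: Timar2006, §4 (proof of Thm. 4.3: the edge sets of boxes of different generations are disjoint)] -/
theorem boxEdges_weight {x x' : V} {A : ℝ≥0∞} {r : ℕ} (hx' : x' ∈ η.lowSet x)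
    {e : Sym2 V} (he : e ∈ η.boxEdges x x' A r) :
    (∀ u ∈ e, A < η.height u) ∧ ∃ u ∈ e, u ∈ η.lowSet x := by
  rcases he with he | ⟨u, v, rfl, hu, hulow, -, hvA, -⟩
  · induction e using Sym2.ind with
    | h u v =>
      have hadj := (SimpleGraph.mem_edgeSet _).1 he
      refine ⟨fun w hw => ?_, ?_⟩
      · rcases Sym2.mem_iff.1 hw with rfl | rfl
        · exact hadj.2.1.1
        · exact hadj.2.2.1
      · rcases hadj.1.2 with ⟨hul, -⟩ | hxx
        · exact ⟨u, Sym2.mem_mk_left u v, hul⟩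
        · exact ⟨x', by rw [hxx]; exact Sym2.mem_mk_right x x', hx'⟩
  · refine ⟨fun w hw => ?_, ⟨u, Sym2.mem_mk_left u v, hulow⟩⟩
    rcases Sym2.mem_iff.1 hw with rfl | rfl
    · exact hu.1
    · exact hvA

end Box

/-! ### Measurability -/

section Measurable

variable {G : SimpleGraph V} [G.LocallyFinite] {o : V} (η : HeightSystem G o) [Countable V]

/-- `{y ∈ boxCluster}` is measurable. [folklore] -/
theorem measurableSet_mem_boxCluster (x x' : V) (A : ℝ≥0∞) (r : ℕ) (y : V) :
    MeasurableSet {ω | y ∈ η.boxCluster x x' A r ω} :=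
  measurableSet_openConnVia _ x y

/-- The sealedness event is measurable. [folklore] -/
theorem measurableSet_boxSealed (x x' : V) (A : ℝ≥0∞) (r : ℕ) :
    MeasurableSet {ω | η.BoxSealed x x' A r ω} := by
  have heq : {ω | η.BoxSealed x x' A r ω} =
      ⋂ u : V, ⋂ v : V, {ω | u ∈ η.boxCluster x x' A r ω → s(u, v) ∈ ω →
        (u ≠ x → G.Adj u v →
          (v ∈ η.boxSet x A r ∧ (v ∈ η.lowSet x ∨ v = x)) ∨ η.height v ≤ A)} := by
    ext ω
    simp only [BoxSealed, Set.mem_setOf_eq, Set.mem_iInter]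
    constructor
    · intro h u v hu hopen hux hG
      exact h u hu hux v hG hopen
    · intro h u hu hux v hG hopen
      exact h u v hu hopen hux hG
  rw [heq]
  refine MeasurableSet.iInter fun u => MeasurableSet.iInter fun v => ?_
  by_cases hP : (u ≠ x → G.Adj u v →
      (v ∈ η.boxSet x A r ∧ (v ∈ η.lowSet x ∨ v = x)) ∨ η.height v ≤ A)
  · have : {ω : BondConfig V | u ∈ η.boxCluster x x' A r ω → s(u, v) ∈ ω →
        (u ≠ x → G.Adj u v →
          (v ∈ η.boxSet x A r ∧ (v ∈ η.lowSet x ∨ v = x)) ∨ η.height v ≤ A)} =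
        Set.univ := Set.eq_univ_of_forall fun _ _ _ => hP
    rw [this]
    exact MeasurableSet.univ
  · have : {ω : BondConfig V | u ∈ η.boxCluster x x' A r ω → s(u, v) ∈ ω →
        (u ≠ x → G.Adj u v →
          (v ∈ η.boxSet x A r ∧ (v ∈ η.lowSet x ∨ v = x)) ∨ η.height v ≤ A)} =
        {ω | u ∈ η.boxCluster x x' A r ω}ᶜ ∪ {ω | s(u, v) ∈ ω}ᶜ := by
      ext ω
      simp only [Set.mem_setOf_eq, Set.mem_union, Set.mem_compl_iff]
      tauto
    rw [this]
    exact (η.measurableSet_mem_boxCluster x x' A r u).compl.union (measurable_set_mem _).setOf.compl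

/-- **The good event is measurable** (given `x` lies in its box). [folklore] -/
theorem measurableSet_boxGood {x x' : V} {A : ℝ≥0∞} {r : ℕ} (hxA : x ∈ η.boxSet x A r)
    (k : ℕ) : MeasurableSet (η.boxGood x x' A r k) :=
  (measurableSet_le_encard_inter ((ballSet_finite G x r).subset Set.inter_subset_right)
    (fun ω => η.boxCluster_subset_boxSet hxA ω) (η.measurableSet_mem_boxCluster x x' A r) k).inter
    (η.measurableSet_boxSealed x x' A r)

end Measurable

/-! ### Equivariance under automorphisms ("these events can be mapped into each other by some
automorphisms and our probability measure is invariant under automorphisms") -/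

section Equivariance

variable {G : SimpleGraph V} [G.LocallyFinite] {o : V} (η : HeightSystem G o)

/-- `γ v` is low for `γ x` iff `v` is low for `x`. [folklore] -/
theorem mem_lowSet_map_iff (hconn : G.Connected) (γ : G ≃g G) {x v : V} :
    γ v ∈ η.lowSet (γ x) ↔ v ∈ η.lowSet x := by
  show η.height (γ v) ≤ η.ratio * η.height (γ x) ↔
    η.height v ≤ η.ratio * η.height x
  rw [η.height_map_eq_mul hconn γ v, η.height_map_eq_mul hconn γ x, mul_left_comm]
  exact ENNReal.mul_le_mul_iff_right (η.height_ne_zero hconn _) (η.height_ne_top hconn _)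

/-- `G'(γ x)` with mate `γ x'` is the image of `G'(x)`. [cite: Timar2006, §4 (proof of Thm. 4.3: G'(x) is the image of G'(o))] -/
theorem lowerGraph_map_adj_iff (hconn : G.Connected) (γ : G ≃g G) {x x' u v : V} :
    (η.lowerGraph (γ x) (γ x')).Adj (γ u) (γ v) ↔ (η.lowerGraph x x').Adj u v := by
  simp only [lowerGraph_adj, η.mem_lowSet_map_iff hconn γ, sym2_map_eq_iff γ,
    SimpleGraph.Iso.map_adj_iff]

/-- Boxes are transported, the threshold being rescaled: `γ v ∈ boxSet (γ x) (c A) ↔ v ∈ boxSet x A`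
with `c = w(γ o)`. [folklore] -/
theorem mem_boxSet_map_iff (hconn : G.Connected) (γ : G ≃g G) {x v : V} {A : ℝ≥0∞} {r : ℕ} :
    γ v ∈ η.boxSet (γ x) (η.height (γ o) * A) r ↔ v ∈ η.boxSet x A r := by
  simp only [boxSet, Set.mem_inter_iff, Set.mem_setOf_eq, mem_ballSet_map_iff,
    η.height_map_eq_mul hconn γ v]
  rw [(ENNReal.mul_right_strictMono (η.height_ne_zero hconn _)
    (η.height_ne_top hconn _)).lt_iff_lt]

/-- The box graphs are transported. [folklore] -/
theorem boxGraph_map_adj_iff (hconn : G.Connected) (γ : G ≃g G) {x x' u v : V} {A : ℝ≥0∞}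
    {r : ℕ} :
    (η.boxStepGraph (γ x) (γ x') (η.height (γ o) * A) r).Adj (γ u) (γ v) ↔
      (η.boxStepGraph x x' A r).Adj u v := by
  simp only [boxStepGraph, withinGraph_adj, η.lowerGraph_map_adj_iff hconn γ, η.mem_boxSet_map_iff hconn γ]

/-- **The component of the transported box in the relabelled configuration is the image of the
component.** [cite: Timar2006, §4 (proof of Thm. 4.3: "these events can be mapped into each other by some automorphisms")] -/
theorem boxCluster_map (hconn : G.Connected) (γ : G ≃g G) (x x' : V) (A : ℝ≥0∞) (r : ℕ)
    (ω : BondConfig V) :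
    η.boxCluster (γ x) (γ x') (η.height (γ o) * A) r
        (BondConfig.relabel (sym2Equiv γ.toEquiv) ω) =
      (γ : V → V) '' η.boxCluster x x' A r ω :=
  openClusterIn_relabel γ.toEquiv (fun _ _ => η.boxGraph_map_adj_iff hconn γ) ω x

/-- Windows are transported. [folklore] -/
theorem mem_wwindow_map_iff (hconn : G.Connected) (γ : G ≃g G) {v : V} {A : ℝ≥0∞} :
    γ v ∈ η.wwindow (η.height (γ o) * A) ↔ v ∈ η.wwindow A := by
  have h0 := η.height_ne_zero hconn (γ o)
  have hT := η.height_ne_top hconn (γ o)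
  simp only [wwindow, Set.mem_setOf_eq, η.height_map_eq_mul hconn γ v]
  rw [(ENNReal.mul_right_strictMono h0 hT).lt_iff_lt, mul_assoc, ENNReal.mul_le_mul_iff_right h0 hT]

/-- The weight comparison with the threshold is transported. [folklore] -/
theorem autWeight_map_le_iff (hconn : G.Connected) (γ : G ≃g G) {v : V} {A : ℝ≥0∞} :
    η.height (γ v) ≤ η.height (γ o) * A ↔ η.height v ≤ A := by
  rw [η.height_map_eq_mul hconn γ v]
  exact ENNReal.mul_le_mul_iff_right (η.height_ne_zero hconn _) (η.height_ne_top hconn _)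

/-- Sealedness is transported. [folklore] -/
theorem boxSealed_map_iff (hconn : G.Connected) (γ : G ≃g G) {x x' : V} {A : ℝ≥0∞} {r : ℕ}
    {ω : BondConfig V} :
    η.BoxSealed (γ x) (γ x') (η.height (γ o) * A) r
        (BondConfig.relabel (sym2Equiv γ.toEquiv) ω) ↔
      η.BoxSealed x x' A r ω := by
  unfold BoxSealed
  rw [η.boxCluster_map hconn γ x x' A r ω]
  constructor
  · intro h u hu hux v hG hopen
    have h' := h (γ u) ⟨u, hu, rfl⟩ (γ.injective.ne hux) (γ v)
      ((SimpleGraph.Iso.map_adj_iff γ).2 hG) ((mk_mem_relabel_iff γ.toEquiv ω u v).2 hopen)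
    rwa [η.mem_boxSet_map_iff hconn γ, η.mem_lowSet_map_iff hconn γ, γ.injective.eq_iff,
      η.autWeight_map_le_iff hconn γ] at h'
  · rintro h _ ⟨u, hu, rfl⟩ hux v' hG' hopen'
    obtain ⟨v, rfl⟩ : ∃ v, γ v = v' := ⟨γ.symm v', γ.apply_symm_apply v'⟩
    have hG : G.Adj u v := (SimpleGraph.Iso.map_adj_iff γ).1 hG'
    have hopen : s(u, v) ∈ ω := (mk_mem_relabel_iff γ.toEquiv ω u v).1 hopen'
    have h' := h u hu (fun hu' => hux (congrArg γ hu')) v hG hopen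
    rwa [η.mem_boxSet_map_iff hconn γ, η.mem_lowSet_map_iff hconn γ, γ.injective.eq_iff,
      η.autWeight_map_le_iff hconn γ]

/-- **The good event is transported**: `γ·ω` is good for the box of `γ x` (mate `γ x'`,
threshold `w(γ o) A`) iff `ω` is good for the box of `x` (mate `x'`, threshold `A`).
[cite: Timar2006, §4 (proof of Thm. 4.3: "the probability of F(x) =: F is independent of x because these events can be mapped into each other by some automorphisms")] -/
theorem relabel_mem_boxGood_iff (hconn : G.Connected) (γ : G ≃g G) {x x' : V} {A : ℝ≥0∞}
    {r k : ℕ} {ω : BondConfig V} :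
    BondConfig.relabel (sym2Equiv γ.toEquiv) ω ∈
        η.boxGood (γ x) (γ x') (η.height (γ o) * A) r k ↔
      ω ∈ η.boxGood x x' A r k := by
  simp only [boxGood, Set.mem_setOf_eq, η.boxSealed_map_iff hconn γ, η.boxCluster_map hconn γ]
  have himg : (γ : V → V) '' η.boxCluster x x' A r ω ∩ η.wwindow (η.height (γ o) * A) =
      (γ : V → V) '' (η.boxCluster x x' A r ω ∩ η.wwindow A) := by
    ext v'
    constructor
    · rintro ⟨⟨v, hv, rfl⟩, hw⟩
      exact ⟨v, ⟨hv, (η.mem_wwindow_map_iff hconn γ).1 hw⟩, rfl⟩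
    · rintro ⟨v, ⟨hv, hw⟩, rfl⟩
      exact ⟨⟨v, hv, rfl⟩, (η.mem_wwindow_map_iff hconn γ).2 hw⟩
  rw [himg, γ.injective.encard_image]

/-- Preimage form of `relabel_mem_boxGood_iff`. [folklore] -/
theorem preimage_relabel_boxGood (hconn : G.Connected) (γ : G ≃g G) (x x' : V) (A : ℝ≥0∞)
    (r k : ℕ) :
    BondConfig.relabel (sym2Equiv γ.toEquiv) ⁻¹'
        η.boxGood (γ x) (γ x') (η.height (γ o) * A) r k =
      η.boxGood x x' A r k := by
  ext ω
  rw [Set.mem_preimage]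
  exact η.relabel_mem_boxGood_iff hconn γ

/-- **The probability of being good is the same for a box and its image under an automorphism**
(invariance of `P_p` under `Aut(G)`, `bondPercolation_map_relabel_iso`).
[cite: Timar2006, §4 (proof of Thm. 4.3: "our probability measure is invariant under automorphisms")] -/
theorem measure_boxGood_map (hconn : G.Connected) (γ : G ≃g G) (p : unitInterval) (x x' : V)
    (A : ℝ≥0∞) (r k : ℕ) :
    bondPercolation G p (η.boxGood (γ x) (γ x') (η.height (γ o) * A) r k) =
      bondPercolation G p (η.boxGood x x' A r k) := by
  calc bondPercolation G p (η.boxGood (γ x) (γ x') (η.height (γ o) * A) r k)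
      = ((bondPercolation G p).map (BondConfig.relabel (sym2Equiv γ.toEquiv)))
          (η.boxGood (γ x) (γ x') (η.height (γ o) * A) r k) := by
        rw [bondPercolation_map_relabel_iso]
    _ = bondPercolation G p (BondConfig.relabel (sym2Equiv γ.toEquiv) ⁻¹'
          η.boxGood (γ x) (γ x') (η.height (γ o) * A) r k) :=
        MeasurableEquiv.map_apply _ _
    _ = bondPercolation G p (η.boxGood x x' A r k) := by
        rw [η.preimage_relabel_boxGood hconn γ]

end Equivariance


/-! ### Nice clusters and the event `F(x)` -/

section Nice

variable {G : SimpleGraph V} [G.LocallyFinite] {o : V} (η : HeightSystem G o)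

/-- **Nice** (`C(x) = C(x)|_{G'(x)}`), in closed-edge form: the only open edge of `G` at `x` is
the long edge `{x, x'}`, and a vertex of `C(x)` other than `x` has open edges only to vertices of
weight `≤ Δ w(x)` or to `x`. [cite: Timar2006, §4 (proof of Thm. 4.3: "C(x) is nice if C(x) = C(x)|_{G'(x)}")] -/
def IsNice (η : HeightSystem G o) (x x' : V) (ω : BondConfig V) : Prop :=
  (∀ y : V, G.Adj x y → s(x, y) ∈ ω → y = x') ∧
    ∀ u ∈ openCluster ω x, u ≠ x → ∀ v : V, G.Adj u v → s(u, v) ∈ ω → v ∈ η.lowSet x ∨ v = x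

/-- **The event `F(x)`**: `C(x)` is infinite, light and nice.
[cite: Timar2006, §4 (proof of Thm. 4.3: "Let F(x) be the event that C(x) is infinite, light and nice")] -/
def niceEvent (η : HeightSystem G o) (x x' : V) : Set (BondConfig V) :=
  {ω | (openCluster ω x).Infinite ∧ ¬ IsHeavy G o (openCluster ω x) ∧ η.IsNice x x' ω}

/-- Along an open walk from a vertex of `C(x)` which is `x` or low, in a nice configuration on
`E(G)`, every vertex is `x` or low (for `x'` low). [folklore] -/
theorem eq_or_mem_lowSet_of_nice_walk (hconn : G.Connected) {x x' : V} (hx' : x' ∈ η.lowSet x)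
    {ω : BondConfig V}
    (hω : ω ⊆ G.edgeSet) (hnice : η.IsNice x x' ω) :
    ∀ {c d : V} (_ : (openGraph ω).Walk c d), c ∈ openCluster ω x → (c = x ∨ c ∈ η.lowSet x) →
      (d = x ∨ d ∈ η.lowSet x)
  | _, _, .nil, _, h => h
  | c, d, .cons (v := e) hadj q, hc, h => by
    have hopen : s(c, e) ∈ ω := ((openGraph_adj ω c e).1 hadj).1
    have hne : c ≠ e := ((openGraph_adj ω c e).1 hadj).2
    have hG : G.Adj c e := (SimpleGraph.mem_edgeSet G).1 (hω hopen)
    have he : e ∈ openCluster ω x := mem_openCluster_of_adj hc hopen hne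
    refine eq_or_mem_lowSet_of_nice_walk hconn hx' hω hnice q he ?_
    rcases h with rfl | hclow
    · exact Or.inr ((hnice.1 e hG hopen) ▸ hx')
    · have hcx : c ≠ x := fun hcx => η.not_mem_lowSet_self hconn x (hcx ▸ hclow)
      rcases hnice.2 c hc hcx e hG hopen with helow | rfl
      · exact Or.inr helow
      · exact Or.inl rfl

/-- **The vertices of a nice cluster other than `x` are low.** [cite: Timar2006, §4 (proof of Thm. 4.3: nice clusters live in G'(x))] -/
theorem mem_lowSet_of_nice (hconn : G.Connected) {x x' : V} (hx' : x' ∈ η.lowSet x) {ω : BondConfig V}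
    (hω : ω ⊆ G.edgeSet) (hnice : η.IsNice x x' ω) {u : V} (hu : u ∈ openCluster ω x)
    (hux : u ≠ x) : u ∈ η.lowSet x := by
  obtain ⟨p⟩ := hu
  exact (η.eq_or_mem_lowSet_of_nice_walk hconn hx' hω hnice p (mem_openCluster_self ω x)
    (Or.inl rfl)).resolve_left hux

/-! ### Good boxes from nice clusters -/

/-- **On `F`-type configurations the box of `x` is good**: if `ω` (on `E(G)`) is nice at `x` with
a low mate `x'`, `A < w(x)`, the vertices of `C(x)` of weight `> A` all lie in `B(x, r)`, and the
cluster of `x` inside `{w > A}` has at least `k` vertices in the window `(A, A Δ⁻¹]`, then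
`ω ∈ η.boxGood x x' A r k`: the constrained cluster lies in the component of the box (its steps
are steps of `G'(x)` by niceness, inside the ball by the containment), and the component is sealed
(an open edge from `C(x) ∖ {x}` leads to a low vertex of `C(x)`, inside the box if of weight `> A`,
or to `x`). [cite: Timar2006, §4 (proof of Thm. 4.3: choice of i and r making B_o(i; r) good)] -/
theorem boxGood_of_nice (hconn : G.Connected) {x x' : V} (hx' : x' ∈ η.lowSet x) {A : ℝ≥0∞} {r k : ℕ}
    (hxA : A < η.height x) {ω : BondConfig V} (hω : ω ⊆ G.edgeSet) (hnice : η.IsNice x x' ω)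
    (hcont : openCluster ω x ∩ {v | A < η.height v} ⊆ ballSet G x r)
    (hmany : (k : ℕ∞) ≤ (openClusterIn (withinGraph G {v | A < η.height v}) ω x ∩
      η.wwindow A).encard) :
    ω ∈ η.boxGood x x' A r k := by
  have hxbox : x ∈ η.boxSet x A r := η.mem_boxSet_self hxA r
  -- one step of the constrained cluster is a step of the box graph
  have step : ∀ {c d : V}, c ∈ η.boxCluster x x' A r ω →
      (openGraph ω ⊓ withinGraph G {v | A < η.height v}).Adj c d →
      d ∈ η.boxCluster x x' A r ω := by
    intro c d hc hadj
    have hopen : s(c, d) ∈ ω := ((openGraph_adj ω c d).1 hadj.1).1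
    have hne : c ≠ d := ((openGraph_adj ω c d).1 hadj.1).2
    have hG : G.Adj c d := hadj.2.1
    have hdA : A < η.height d := hadj.2.2.2
    have hcC : c ∈ openCluster ω x := η.boxCluster_subset_openCluster x x' A r ω hc
    have hdC : d ∈ openCluster ω x := mem_openCluster_of_adj hcC hopen hne
    have hdbox : d ∈ η.boxSet x A r := ⟨hdA, hcont ⟨hdC, hdA⟩⟩
    have hlow : (c ∈ η.lowSet x ∧ d ∈ η.lowSet x) ∨ s(c, d) = s(x, x') := by
      by_cases hcx : c = x
      · subst hcx
        exact Or.inr (by rw [hnice.1 d hG hopen])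
      · have hclow : c ∈ η.lowSet x := η.mem_lowSet_of_nice hconn hx' hω hnice hcC hcx
        rcases hnice.2 c hcC hcx d hG hopen with hdlow | rfl
        · exact Or.inl ⟨hclow, hdlow⟩
        · -- `d = x`: the open edge `{c, x}` at `x` forces `c = x'`
          have hcx' : c = x' := hnice.1 c hG.symm (by rw [Sym2.eq_swap]; exact hopen)
          exact Or.inr (by rw [hcx', Sym2.eq_swap])
    exact mem_openClusterIn_of_adj hc ⟨⟨hG, hlow⟩, η.boxCluster_subset_boxSet hxbox ω hc, hdbox⟩ hopen
  have key : ∀ {c v : V} (_ : (openGraph ω ⊓ withinGraph G {v | A < η.height v}).Walk c v),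
      c ∈ η.boxCluster x x' A r ω → v ∈ η.boxCluster x x' A r ω := by
    intro c v W
    induction W with
    | nil => exact id
    | cons hadj _ ih => exact fun hc => ih (step hc hadj)
  have hsub : openClusterIn (withinGraph G {v | A < η.height v}) ω x ⊆
      η.boxCluster x x' A r ω := by
    intro v hv
    rw [mem_openClusterIn_iff] at hv
    obtain ⟨W⟩ := hv
    exact key W (self_mem_openClusterIn _ ω x)
  refine ⟨hmany.trans (Set.encard_le_encard (Set.inter_subset_inter_left _ hsub)), ?_⟩
  -- sealed
  intro u hu hux v hG hopen
  have huC : u ∈ openCluster ω x := η.boxCluster_subset_openCluster x x' A r ω hu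
  by_cases hvA : η.height v ≤ A
  · exact Or.inr hvA
  have hvA' : A < η.height v := not_le.1 hvA
  have hvC : v ∈ openCluster ω x := mem_openCluster_of_adj huC hopen hG.ne
  exact Or.inl ⟨⟨hvA', hcont ⟨hvC, hvA'⟩⟩, hnice.2 u huC hux v hG hopen⟩

/-! ### Measurability -/

section Measurable

variable [Countable V]

omit [G.LocallyFinite] in
/-- The niceness event is measurable. [folklore] -/
theorem measurableSet_isNice (x x' : V) : MeasurableSet {ω : BondConfig V | η.IsNice x x' ω} := by
  have h1 : MeasurableSet {ω : BondConfig V | ∀ y : V, G.Adj x y → s(x, y) ∈ ω → y = x'} := by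
    have : {ω : BondConfig V | ∀ y : V, G.Adj x y → s(x, y) ∈ ω → y = x'} =
        ⋂ y : V, {ω | x ∈ openCluster ω x → s(x, y) ∈ ω → (G.Adj x y → y = x')} := by
      ext ω; simp only [Set.mem_setOf_eq, Set.mem_iInter]
      exact ⟨fun h y _ hy hG => h y hG hy, fun h y hG hy => h y (mem_openCluster_self ω x) hy hG⟩
    rw [this]
    exact MeasurableSet.iInter fun y =>
      measurableSet_imp_imp (measurableSet_mem_openCluster x x) _ _
  have h2 : MeasurableSet {ω : BondConfig V | ∀ u ∈ openCluster ω x, u ≠ x → ∀ v : V, G.Adj u v →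
      s(u, v) ∈ ω → v ∈ η.lowSet x ∨ v = x} := by
    have : {ω : BondConfig V | ∀ u ∈ openCluster ω x, u ≠ x → ∀ v : V, G.Adj u v →
        s(u, v) ∈ ω → v ∈ η.lowSet x ∨ v = x} =
        ⋂ u : V, ⋂ v : V, {ω | u ∈ openCluster ω x → s(u, v) ∈ ω →
          (u ≠ x → G.Adj u v → v ∈ η.lowSet x ∨ v = x)} := by
      ext ω; simp only [Set.mem_setOf_eq, Set.mem_iInter]
      exact ⟨fun h u v hu hopen hux hG => h u hu hux v hG hopen,
        fun h u hu hux v hG hopen => h u v hu hopen hux hG⟩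
    rw [this]
    exact MeasurableSet.iInter fun u => MeasurableSet.iInter fun v =>
      measurableSet_imp_imp (measurableSet_mem_openCluster x u) _ _
  exact h1.inter h2

omit [G.LocallyFinite] in
/-- **`F(x)` is measurable.** [folklore] -/
theorem measurableSet_niceEvent (x x' : V) : MeasurableSet (η.niceEvent x x') := by
  have : η.niceEvent x x' = percolatesAt x ∩
      ({ω | IsHeavy G o (openCluster ω x)}ᶜ ∩ {ω | η.IsNice x x' ω}) := by
    ext ω
    simp only [niceEvent, percolatesAt, Set.mem_setOf_eq, Set.mem_inter_iff, Set.mem_compl_iff]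
  rw [this]
  exact (measurableSet_percolatesAt_holds x).inter
    ((measurableSet_isHeavy_openCluster G o x).compl.inter
      (η.measurableSet_isNice (G := G) (o := o) x x'))

end Measurable

/-! ### `q > 0`: uppermost vertices, transport to `o'`, and the surgery at `o` -/

/-- The event "`C(t)` is infinite and light and `t` is an uppermost vertex of it".
[cite: Timar2006, §4 (proof of Thm. 4.3: "the event that o' is an uppermost vertex of a light cluster")] -/
def uppermostEvent (η : HeightSystem G o) (t : V) : Set (BondConfig V) :=
  {ω | (openCluster ω t).Infinite ∧ ¬ IsHeavy G o (openCluster ω t) ∧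
    ∀ u ∈ openCluster ω t, η.height u ≤ η.height t}

/-- **An infinite light cluster has an uppermost vertex**: if `C(x)` is infinite and light, some
`t ∈ C(x)` has `C(t) = C(x)` infinite, light, with all weights on it `≤ w(t)`.
[cite: Timar2006, §2 ("Infinite Bernoulli(p) clusters of a grandmother graph have finitely many uppermost vertices") and §4 (proof of Thm. 4.3)] -/
theorem exists_uppermost (hconn : G.Connected) {x : V} {ω : BondConfig V}
    (hinf : (openCluster ω x).Infinite) (hlight : ¬ IsHeavy G o (openCluster ω x)) :
    ∃ t : V, ω ∈ η.uppermostEvent t := by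
  -- the finite nonempty set of vertices of `C(x)` of weight `≥ w(x)` has a heaviest element
  have hfin := η.finite_inter_height_of_not_isHeavy hlight (η.height_ne_zero hconn x)
  have hne : (openCluster ω x ∩ {v | η.height x ≤ η.height v}).Nonempty :=
    ⟨x, mem_openCluster_self ω x, (le_rfl : η.height x ≤ η.height x)⟩
  obtain ⟨t, ⟨htC, htx⟩, hmax⟩ := Set.Finite.exists_maximalFor (η.height) _ hfin hne
  refine ⟨t, ?_, ?_, ?_⟩
  · rw [openCluster_eq_openCluster_of_mem htC]; exact hinf
  · rw [openCluster_eq_openCluster_of_mem htC]; exact hlight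
  · intro u hu
    rw [openCluster_eq_openCluster_of_mem htC] at hu
    by_cases hux : η.height x ≤ η.height u
    · rcases le_total (η.height t) (η.height u) with h | h
      · exact hmax ⟨hu, hux⟩ h
      · exact h
    · exact ((not_le.1 hux).le).trans htx

/-- The uppermost event is carried by automorphisms. [folklore] -/
theorem relabel_mem_uppermostEvent_iff (hconn : G.Connected) (γ : G ≃g G) {t : V}
    {ω : BondConfig V} :
    BondConfig.relabel (sym2Equiv γ.toEquiv) ω ∈ η.uppermostEvent (γ t) ↔
      ω ∈ η.uppermostEvent t := by
  have hC : openCluster (BondConfig.relabel (sym2Equiv γ.toEquiv) ω) (γ t) =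
      (γ : V → V) '' openCluster ω t := (image_openCluster_relabel γ.toEquiv ω t).symm
  have h0 := η.height_ne_zero hconn (γ o)
  have hT := η.height_ne_top hconn (γ o)
  simp only [uppermostEvent, Set.mem_setOf_eq, hC, Set.infinite_image_iff γ.injective.injOn,
    isHeavy_image_iff G hconn γ o]
  refine and_congr_right fun _ => and_congr_right fun _ => ?_
  constructor
  · intro h u hu
    have := h (γ u) ⟨u, hu, rfl⟩
    rwa [η.height_map_eq_mul hconn γ u, η.height_map_eq_mul hconn γ t, ENNReal.mul_le_mul_iff_right h0 hT]
      at this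
  · rintro h _ ⟨u, hu, rfl⟩
    rw [η.height_map_eq_mul hconn γ u, η.height_map_eq_mul hconn γ t, ENNReal.mul_le_mul_iff_right h0 hT]
    exact h u hu

/-- Hence the uppermost events at the vertices of one orbit have one probability. [cite: Timar2006, §4 (proof of Thm. 4.3: invariance under automorphisms)] -/
theorem measure_uppermostEvent_map (hconn : G.Connected) (γ : G ≃g G) (p : unitInterval) (t : V) :
    bondPercolation G p (η.uppermostEvent (γ t)) = bondPercolation G p (η.uppermostEvent t) := by
  have hpre : BondConfig.relabel (sym2Equiv γ.toEquiv) ⁻¹' η.uppermostEvent (γ t) =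
      η.uppermostEvent t := by
    ext ω; rw [Set.mem_preimage]; exact η.relabel_mem_uppermostEvent_iff hconn γ
  calc bondPercolation G p (η.uppermostEvent (γ t))
      = ((bondPercolation G p).map (BondConfig.relabel (sym2Equiv γ.toEquiv)))
          (η.uppermostEvent (γ t)) := by rw [bondPercolation_map_relabel_iso]
    _ = bondPercolation G p
          (BondConfig.relabel (sym2Equiv γ.toEquiv) ⁻¹' η.uppermostEvent (γ t)) :=
        MeasurableEquiv.map_apply _ _
    _ = bondPercolation G p (η.uppermostEvent t) := by rw [hpre]

/-- **The surgery produces `F(o)`** ("insert the edge between `o` and `o'` and delete all other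
edges incident to `o`. In the resulting configurations …, `C(o)` is nice"): for `ω` on `E(G)` in
the uppermost event at `o'` (a neighbour of `o` of weight `Δ`), the configuration
`(ω ∖ E_o) ∪ {{o, o'}}` (`E_o` the edges of `G` at `o`) lies in `η.niceEvent o o'`.
[cite: Timar2006, §4 (proof of Thm. 4.3: q > 0 by insertion and deletion tolerance)] -/
theorem openEdges_closeEdges_mem_niceEvent (hconn : G.Connected) {o' : V} (hoo' : G.Adj o o')
    (ho' : η.height o' = η.ratio) (F₁ : Finset (Sym2 V))
    (hF₁ : ∀ e : Sym2 V, e ∈ F₁ ↔ e ∈ G.edgeSet ∧ o ∈ e) {ω : BondConfig V} (hω : ω ⊆ G.edgeSet)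
    (hup : ω ∈ η.uppermostEvent o') :
    openEdges (↑({s(o, o')} : Finset (Sym2 V))) (closeEdges ↑F₁ ω) ∈ η.niceEvent o o' := by
  obtain ⟨hinf, hlight, htop⟩ := hup
  set E : Set (Sym2 V) := ↑F₁ with hEdef
  have hE : ∀ y : V, s(o, y) ∈ ω → s(o, y) ∈ E := by
    intro y hy
    rw [hEdef, Finset.mem_coe, hF₁]
    exact ⟨hω hy, Sym2.mem_mk_left o y⟩
  have hE' : ∀ e ∈ E, o ∈ e := by
    intro e he
    rw [hEdef, Finset.mem_coe, hF₁] at he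
    exact he.2
  -- `o ∉ C(o')`: all weights on `C(o')` are `≤ Δ < 1 = w(o)`
  have hΔ1 := η.ratio_lt_one
  have hoC : o ∉ openCluster ω o' := by
    intro h
    have := htop o h
    rw [η.height_base hconn, ho'] at this
    exact absurd this (not_le.2 hΔ1)
  have hCeq : openCluster (ω \ E) o' = openCluster ω o' := openCluster_sdiff_eq_of_notMem hoC E hE'
  -- the new configuration and its cluster at `o`
  have hζ : openEdges (↑({s(o, o')} : Finset (Sym2 V))) (closeEdges E ω) = (ω \ E) ∪ {s(o, o')} := by
    rw [Finset.coe_singleton]; rfl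
  rw [hζ]
  have hsub : openCluster ((ω \ E) ∪ {s(o, o')}) o ⊆ insert o (openCluster ω o') := by
    intro u hu
    obtain ⟨W⟩ := hu
    have := eq_or_mem_openCluster_of_surgery_walk E hE W (Or.inl rfl)
    rw [hCeq] at this
    rcases this with rfl | h
    · exact Set.mem_insert _ _
    · exact Set.mem_insert_of_mem _ h
  have ho'ζ : o' ∈ openCluster ((ω \ E) ∪ {s(o, o')}) o :=
    SimpleGraph.Adj.reachable ((openGraph_adj _ o o').2 ⟨Or.inr rfl, hoo'.ne⟩)
  have hsup : openCluster ω o' ⊆ openCluster ((ω \ E) ∪ {s(o, o')}) o := by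
    rw [← hCeq, ← openCluster_eq_openCluster_of_mem ho'ζ]
    exact openCluster_mono Set.subset_union_left o'
  refine ⟨fun hfin => hinf (hfin.subset hsup), ?_, ?_, ?_⟩
  · -- light: `W(C_ζ(o)) ≤ w(o) + W(C(o')) < ∞`
    intro hheavy
    rw [IsHeavy] at hheavy
    have hle := (setWeight_mono G o hsub).trans (setWeight_insert_le G o o (openCluster ω o'))
    rw [hheavy, top_le_iff, ENNReal.add_eq_top] at hle
    rcases hle with h | h
    · exact autWeight_ne_top G hconn o o h
    · exact hlight h
  · -- the only open edge at `o` is `{o, o'}`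
    intro y hG hy
    rcases hy with hη | hoo
    · exact absurd (hE y hη.1) hη.2
    · rw [Set.mem_singleton_iff, Sym2.eq_iff] at hoo
      rcases hoo with ⟨-, h⟩ | ⟨h1, h2⟩
      · exact h
      · exact h2.trans h1
  · -- vertices of `C_ζ(o) ∖ {o}` have open edges only to low vertices or to `o`
    intro u hu huo v hG hopen
    have huC : u ∈ openCluster ω o' := by
      rcases hsub hu with h | h
      · exact absurd h huo
      · exact h
    rcases hopen with hη | hoo
    · have hv : v ∈ openCluster ω o' := mem_openCluster_of_adj huC hη.1 hG.ne
      left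
      show η.height v ≤ η.ratio * η.height o
      rw [η.height_base hconn, mul_one, ← ho']
      exact htop v hv
    · rw [Set.mem_singleton_iff, Sym2.eq_iff] at hoo
      rcases hoo with ⟨h, -⟩ | ⟨-, h⟩
      · exact absurd h huo
      · exact Or.inr h

/-! ### Toppability on quasi-transitive graphs: every vertex is, with positive probability, an
uppermost vertex of an infinite light cluster

On a TRANSITIVE graph the uppermost event has the same probability at every vertex
(`measure_uppermostEvent_map`), so "`o'` is an uppermost vertex of a light cluster" has positive
probability as soon as light infinite clusters exist. On a quasi-transitive graph this transport
only works inside one orbit; the missing step is supplied by a second surgery along the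
descending long-edge chain of the height system (this subsection; not in the printed proof, whose
§4 is written for transitive graphs). -/

section Toppable

omit [G.LocallyFinite] in
/-- Heights along a walk rise by at most `Δ⁻¹` per step: `h(f i) Δ^i ≤ h(f 0)`. [folklore] -/
theorem height_mul_ratio_pow_le {m : ℕ} {f : ℕ → V} (hf : ∀ i < m, G.Adj (f i) (f (i + 1))) :
    ∀ i ≤ m, η.height (f i) * η.ratio ^ i ≤ η.height (f 0)
  | 0, _ => by rw [pow_zero, mul_one]
  | i + 1, hi => by
    calc η.height (f (i + 1)) * η.ratio ^ (i + 1)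
        = η.ratio * η.height (f (i + 1)) * η.ratio ^ i := by ring
      _ ≤ η.height (f i) * η.ratio ^ i := by
          gcongr; exact η.ratio_mul_height_le' (hf i (by omega))
      _ ≤ η.height (f 0) := height_mul_ratio_pow_le hf i (by omega)

open Classical in
/-- The edges of `G` at the vertices `f 0, …, f (j-1)` (closed by the surgery). [folklore] -/
def starEdges (G : SimpleGraph V) [G.LocallyFinite] (f : ℕ → V) (j : ℕ) : Finset (Sym2 V) :=
  (Finset.range j).biUnion fun i => G.incidenceFinset (f i)

open Classical in
/-- The edges `{f i, f (i+1)}`, `i < j` (opened by the surgery). [folklore] -/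
def pathEdges (f : ℕ → V) (j : ℕ) : Finset (Sym2 V) :=
  (Finset.range j).image fun i => s(f i, f (i + 1))

/-- Membership in `starEdges`. [folklore] -/
theorem mem_starEdges_iff {f : ℕ → V} {j : ℕ} {e : Sym2 V} :
    e ∈ starEdges G f j ↔ ∃ i < j, e ∈ G.edgeSet ∧ f i ∈ e := by
  classical
  simp only [starEdges, Finset.mem_biUnion, Finset.mem_range, SimpleGraph.mem_incidenceFinset,
    SimpleGraph.incidenceSet, Set.mem_setOf_eq]

omit [G.LocallyFinite] in
/-- Membership in `pathEdges`. [folklore] -/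
theorem mem_pathEdges_iff {f : ℕ → V} {j : ℕ} {e : Sym2 V} :
    e ∈ pathEdges f j ↔ ∃ i < j, s(f i, f (i + 1)) = e := by
  classical
  simp only [pathEdges, Finset.mem_image, Finset.mem_range]

/-- **The surgery along a walk descending onto an uppermost cluster.** Let `f 0 = z, …, f m = t`
be a walk all of whose vertices have height `≤ h(z)`, with `h(t) < h(z)`, and let `ω` (on
`E(G)`) lie in the uppermost event at `t`; let `j` be the first index with `f j ∈ C(t)`. Closing
all edges at `f 0, …, f (j-1)` and opening the edges `{f i, f (i+1)}`, `i < j`, produces a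
configuration in the uppermost event at `z`: its cluster at `z` is `{f 0, …, f (j-1)} ∪ C(t)`.
[cite: Timar2006, §4 (proof of Thm. 4.3: "insert the edge … and delete all other edges incident to o", the insertion/deletion-tolerance step)] -/
theorem surgery_mem_uppermostEvent (hconn : G.Connected) {z t : V} {m : ℕ} {f : ℕ → V}
    (hf0 : f 0 = z) (hf : ∀ i < m, G.Adj (f i) (f (i + 1)))
    (hle : ∀ i ≤ m, η.height (f i) ≤ η.height z) (htz : η.height t < η.height z)
    {ω : BondConfig V} (hω : ω ⊆ G.edgeSet) (hup : ω ∈ η.uppermostEvent t)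
    {j : ℕ} (hjm : j ≤ m) (hjC : f j ∈ openCluster ω t)
    (hmin : ∀ i < j, f i ∉ openCluster ω t) :
    openEdges (↑(pathEdges f j)) (closeEdges (↑(starEdges G f j)) ω) ∈ η.uppermostEvent z := by
  classical
  obtain ⟨hinf, hlight, htop⟩ := hup
  set Ec : Set (Sym2 V) := ↑(starEdges G f j) with hEc
  set Eo : Set (Sym2 V) := ↑(pathEdges f j) with hEo
  set ζ : BondConfig V := (ω \ Ec) ∪ Eo with hζdef
  have hζ : openEdges Eo (closeEdges Ec ω) = ζ := rfl
  rw [hζ]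
  -- (i) closing `Ec` does not touch `C(t)`
  have hCeq : openCluster (ω \ Ec) t = openCluster ω t := by
    refine openCluster_sdiff_eq_of_forall_exists_notMem' Ec fun e he => ?_
    rw [hEc, Finset.mem_coe, mem_starEdges_iff] at he
    obtain ⟨i, hi, -, hfi⟩ := he
    exact ⟨f i, hfi, hmin i hi⟩
  -- (ii) the opened path joins `z` to `f j`
  have hpath : ∀ i ≤ j, f i ∈ openCluster ζ z := by
    intro i
    induction i with
    | zero => intro; rw [hf0]; exact mem_openCluster_self ζ z
    | succ i ih =>
      intro hi
      have hprev := ih (by omega)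
      have hadj : G.Adj (f i) (f (i + 1)) := hf i (by omega)
      have hopen : s(f i, f (i + 1)) ∈ ζ := by
        refine Or.inr ?_
        rw [hEo, Finset.mem_coe, mem_pathEdges_iff]
        exact ⟨i, by omega, rfl⟩
      exact mem_openCluster_of_adj hprev hopen hadj.ne
  have hfj : f j ∈ openCluster ζ z := hpath j le_rfl
  -- (iii) `C(t) ⊆ C_ζ(z)`
  have hsup : openCluster ω t ⊆ openCluster ζ z := by
    rw [← openCluster_eq_openCluster_of_mem hfj, ← hCeq]
    have hfj' : f j ∈ openCluster (ω \ Ec) t := by rw [hCeq]; exact hjC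
    rw [← openCluster_eq_openCluster_of_mem hfj']
    exact openCluster_mono Set.subset_union_left (f j)
  -- (iv) `C_ζ(z) ⊆ {f i : i < j} ∪ C(t)`
  set S : Set V := {v | ∃ i < j, f i = v} with hS
  have hstep : ∀ {c d : V}, (c ∈ S ∨ c ∈ openCluster ω t) → (openGraph ζ).Adj c d →
      (d ∈ S ∨ d ∈ openCluster ω t) := by
    intro c d hc hadj
    have hopen : s(c, d) ∈ ζ := ((openGraph_adj ζ c d).1 hadj).1
    have hne : c ≠ d := ((openGraph_adj ζ c d).1 hadj).2
    rcases hopen with ⟨hω', hnotc⟩ | heo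
    · -- an edge of `ω ∖ Ec`: not at a vertex of `S`
      rcases hc with ⟨i, hi, rfl⟩ | hcC
      · exfalso
        refine hnotc ?_
        rw [hEc, Finset.mem_coe, mem_starEdges_iff]
        exact ⟨i, hi, hω hω', Sym2.mem_mk_left _ _⟩
      · exact Or.inr (mem_openCluster_of_adj hcC hω' hne)
    · -- an opened path edge
      rw [hEo, Finset.mem_coe, mem_pathEdges_iff] at heo
      obtain ⟨i, hi, he⟩ := heo
      have hd : d = f i ∨ d = f (i + 1) := by
        have hdmem : d ∈ s(f i, f (i + 1)) := by rw [he]; exact Sym2.mem_mk_right c d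
        rcases Sym2.mem_iff.1 hdmem with h | h
        · exact Or.inl h
        · exact Or.inr h
      rcases hd with rfl | rfl
      · exact Or.inl ⟨i, hi, rfl⟩
      · by_cases hij : i + 1 < j
        · exact Or.inl ⟨i + 1, hij, rfl⟩
        · have : i + 1 = j := by omega
          rw [this]; exact Or.inr hjC
  have hkey : ∀ {c d : V} (_ : (openGraph ζ).Walk c d), (c ∈ S ∨ c ∈ openCluster ω t) →
      (d ∈ S ∨ d ∈ openCluster ω t) := by
    intro c d W
    induction W with
    | nil => exact id
    | cons hadj _ ih => exact fun hc => ih (hstep hc hadj)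
  have hsub : openCluster ζ z ⊆ S ∪ openCluster ω t := by
    intro u hu
    obtain ⟨W⟩ := hu
    have hz : z ∈ S ∨ z ∈ openCluster ω t := by
      rcases Nat.eq_zero_or_pos j with hj0 | hj0
      · -- `j = 0`: then `z = f 0 ∈ C(t)`, impossible by the heights
        exfalso
        rw [hj0, hf0] at hjC
        exact absurd (htop z hjC) (not_le.2 htz)
      · exact Or.inl ⟨0, hj0, hf0⟩
    exact hkey W hz
  have hSfin : S.Finite := by
    refine (Set.finite_lt_nat j).image f |>.subset ?_
    rintro v ⟨i, hi, rfl⟩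
    exact ⟨i, hi, rfl⟩
  refine ⟨fun hfin => hinf (hfin.subset hsup), ?_, ?_⟩
  · -- light
    intro hheavy
    rcases isHeavy_union_iff.1 (hheavy.mono hsub) with h | h
    · exact not_isHeavy_of_finite G hconn o hSfin h
    · exact hlight h
  · -- uppermost
    intro u hu
    rcases hsub hu with ⟨i, hi, rfl⟩ | huC
    · exact hle i (by omega)
    · exact (htop u huC).trans htz.le

omit [G.LocallyFinite] in
/-- The uppermost event is measurable. [folklore] -/
theorem measurableSet_uppermostEvent [Countable V] (t : V) : MeasurableSet (η.uppermostEvent t) := by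
  have h3 : MeasurableSet {ω : BondConfig V | ∀ u ∈ openCluster ω t, η.height u ≤ η.height t} := by
    have : {ω : BondConfig V | ∀ u ∈ openCluster ω t, η.height u ≤ η.height t} =
        ⋂ u : V, {ω | u ∈ openCluster ω t → s(t, t) ∈ ω → η.height u ≤ η.height t} ∩
          {ω | u ∈ openCluster ω t → s(t, t) ∉ ω → η.height u ≤ η.height t} := by
      ext ω
      simp only [Set.mem_setOf_eq, Set.mem_iInter, Set.mem_inter_iff]
      constructor
      · intro h u; exact ⟨fun hu _ => h u hu, fun hu _ => h u hu⟩
      · intro h u hu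
        by_cases he : s(t, t) ∈ ω
        · exact (h u).1 hu he
        · exact (h u).2 hu he
    rw [this]
    refine MeasurableSet.iInter fun u => (measurableSet_imp_imp (measurableSet_mem_openCluster t u) _ _).inter ?_
    by_cases hP : η.height u ≤ η.height t
    · have : {ω : BondConfig V | u ∈ openCluster ω t → s(t, t) ∉ ω → η.height u ≤ η.height t} =
          Set.univ := Set.eq_univ_of_forall fun _ _ _ => hP
      rw [this]; exact MeasurableSet.univ
    · have : {ω : BondConfig V | u ∈ openCluster ω t → s(t, t) ∉ ω → η.height u ≤ η.height t} =
          {ω | u ∈ openCluster ω t}ᶜ ∪ {ω | s(t, t) ∈ ω} := by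
        ext ω; simp only [Set.mem_setOf_eq, Set.mem_union, Set.mem_compl_iff]; tauto
      rw [this]
      exact (measurableSet_mem_openCluster t u).compl.union (measurable_set_mem _).setOf
  have : η.uppermostEvent t = percolatesAt t ∩
      ({ω | IsHeavy G o (openCluster ω t)}ᶜ ∩
        {ω | ∀ u ∈ openCluster ω t, η.height u ≤ η.height t}) := by
    ext ω
    simp only [uppermostEvent, percolatesAt, Set.mem_setOf_eq, Set.mem_inter_iff, Set.mem_compl_iff]
  rw [this]
  exact (measurableSet_percolatesAt_holds t).inter
    ((measurableSet_isHeavy_openCluster G o t).compl.inter h3)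

/-- **Positivity transfers down a walk**: with the walk `f` as in `surgery_mem_uppermostEvent`,
if the uppermost event at `t` has positive probability then so has the uppermost event at `z`
(`0 < p < 1`; deletion tolerance for the closed star, insertion tolerance for the opened path,
after decomposing according to the first index at which the walk meets `C(t)`).
[cite: Timar2006, §4 (proof of Thm. 4.3: q > 0 by insertion and deletion tolerance)] -/
theorem uppermostEvent_ne_zero_of_walk [Countable V] (hconn : G.Connected) {p : unitInterval}
    (hp0 : 0 < (p : ℝ)) (hp1 : (p : ℝ) < 1) {z t : V} {m : ℕ} {f : ℕ → V} (hf0 : f 0 = z)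
    (hfm : f m = t) (hf : ∀ i < m, G.Adj (f i) (f (i + 1)))
    (hle : ∀ i ≤ m, η.height (f i) ≤ η.height z) (htz : η.height t < η.height z)
    (ht : bondPercolation G p (η.uppermostEvent t) ≠ 0) :
    bondPercolation G p (η.uppermostEvent z) ≠ 0 := by
  classical
  set μ := bondPercolation G p with hμ
  have hωE : ∀ᵐ ω ∂μ, ω ⊆ G.edgeSet := ProbabilityTheory.setBernoulli_ae_subset
  set A : Set (BondConfig V) := η.uppermostEvent t ∩ {ω | ω ⊆ G.edgeSet} with hA
  have hAeq : μ A = μ (η.uppermostEvent t) := by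
    refine measure_congr ?_
    filter_upwards [hωE] with ω hω
    exact propext ⟨fun h => h.1, fun h => ⟨h, hω⟩⟩
  -- decompose `A` according to the first index `j` with `f j ∈ C(t)`
  set B : ℕ → Set (BondConfig V) := fun j =>
    A ∩ ({ω | f j ∈ openCluster ω t} ∩ {ω | ∀ i < j, f i ∉ openCluster ω t}) with hB
  have hcover : A ⊆ ⋃ j ∈ Finset.range (m + 1), B j := by
    intro ω hω
    have hex : ∃ j, f j ∈ openCluster ω t := ⟨m, by rw [hfm]; exact mem_openCluster_self ω t⟩
    refine Set.mem_biUnion (Finset.mem_range.2 (Nat.lt_succ_of_le ?_)) ⟨hω, Nat.find_spec hex, ?_⟩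
    · exact Nat.find_min' hex (by rw [hfm]; exact mem_openCluster_self ω t)
    · intro i hi; exact Nat.find_min hex hi
  obtain ⟨j, hjm, hBj⟩ : ∃ j, j ≤ m ∧ μ (B j) ≠ 0 := by
    by_contra h
    push Not at h
    have hle' : μ A ≤ ∑ j ∈ Finset.range (m + 1), μ (B j) :=
      (measure_mono hcover).trans (measure_biUnion_finset_le _ _)
    have hzero : ∑ j ∈ Finset.range (m + 1), μ (B j) = 0 :=
      Finset.sum_eq_zero fun j hj => h j (Nat.le_of_lt_succ (Finset.mem_range.1 hj))
    rw [hzero, nonpos_iff_eq_zero, hAeq] at hle'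
    exact ht hle'
  have hBpos : 0 < μ.real (B j) := by
    rw [measureReal_def, ENNReal.toReal_pos_iff]
    exact ⟨pos_iff_ne_zero.2 hBj, measure_lt_top μ _⟩
  -- deletion of the star, then insertion of the path
  set F₁ : Finset (Sym2 V) := starEdges G f j
  set F₂ : Finset (Sym2 V) := pathEdges f j
  set E : Set (BondConfig V) := openEdges ↑F₂ ⁻¹' η.uppermostEvent z with hEdef
  have hEm : MeasurableSet E := measurable_openEdges _ (η.measurableSet_uppermostEvent z)
  have hE : 0 < μ.real E := by
    refine bondPercolation_real_pos_of_closeEdges G hp1 F₁ hEm hBpos fun ω hω => ?_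
    obtain ⟨⟨hup, hωG⟩, hjC, hmin⟩ := hω
    exact η.surgery_mem_uppermostEvent hconn hf0 hf hle htz hωG hup hjm hjC hmin
  have hF₂ : (↑F₂ : Set (Sym2 V)) ⊆ G.edgeSet := by
    intro e he
    rw [Finset.mem_coe, mem_pathEdges_iff] at he
    obtain ⟨i, hi, rfl⟩ := he
    exact hf i (by omega)
  have hpos := bondPercolation_real_pos_of_openEdges G hp0 F₂ hF₂ (η.measurableSet_uppermostEvent z)
    hE fun ω hω => hω
  rw [measureReal_def, ENNReal.toReal_pos_iff] at hpos
  exact hpos.1.ne'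

/-- **Toppability on quasi-transitive graphs**: under Bernoulli(`p`) bond percolation with
`0 < p < 1` on a connected, locally finite, quasi-transitive graph with a height system, if the
uppermost event has positive probability at one vertex `t₀`, it has positive probability at EVERY
vertex `z`. The walk fed to `uppermostEvent_ne_zero_of_walk`: the descending long-edge chain from
`z` of length `N = R₀ + 1` (`R₀` a radius within which every vertex sees the orbit of `t₀`),
followed by a shortest connection (length `≤ R₀`) to a vertex `t` of the orbit of `t₀`; all its
heights are `≤ h(z)` and `h(t) ≤ Δ h(z) < h(z)`.
[cite: Timar2006, §4 (proof of Thm. 4.3: q > 0)] [cite: Hutchcroft2016, §2 (quasi-transitive setting)] -/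
theorem uppermostEvent_ne_zero_of_isQuasiTransitive [Countable V] (hconn : G.Connected)
    (hqt : IsQuasiTransitive G) {p : unitInterval} (hp0 : 0 < (p : ℝ)) (hp1 : (p : ℝ) < 1)
    {t₀ : V} (ht₀ : bondPercolation G p (η.uppermostEvent t₀) ≠ 0) (z : V) :
    bondPercolation G p (η.uppermostEvent z) ≠ 0 := by
  classical
  obtain ⟨S₀, hS₀⟩ := hqt
  -- every vertex is within `R₀` steps of the orbit of `t₀`
  have hwalk : ∀ s : V, ∃ d : ℕ, StepReach G d s t₀ := fun s => exists_stepReach_of_connected hconn s t₀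
  choose dist hdist using hwalk
  set R₀ : ℕ := S₀.sup dist with hR₀
  set N : ℕ := R₀ + 1 with hN
  -- the chain and its end `v`, a nearby `t` in the orbit of `t₀`
  set v : V := η.downSeq z N with hv
  obtain ⟨γ, hγ⟩ := hS₀ v
  set d : ℕ := dist (γ v) with hd
  have hdR : d ≤ R₀ := Finset.le_sup (f := dist) hγ
  have hvt : StepReach G d v (γ.symm t₀) := by
    have := (hdist (γ v)).map γ.symm
    rwa [RelIso.symm_apply_apply] at this
  set t : V := γ.symm t₀ with ht
  have htpos : bondPercolation G p (η.uppermostEvent t) ≠ 0 := by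
    rw [ht, η.measure_uppermostEvent_map hconn γ.symm p t₀]; exact ht₀
  obtain ⟨g, hg0, hgd, hg⟩ := hvt
  -- the concatenated walk
  set f : ℕ → V := fun i => if i ≤ N then η.downSeq z i else g (i - N) with hf
  have hf0 : f 0 = z := by simp [hf]
  have hfm : f (N + d) = t := by
    rcases Nat.eq_zero_or_pos d with hd0 | hdpos
    · simp only [hf, hd0, Nat.add_zero, le_refl, if_true]
      rw [← hgd, hd0, hg0]
    · have h : ¬ N + d ≤ N := by omega
      simp only [hf, h, if_false, Nat.add_sub_cancel_left, hgd]
  have hfadj : ∀ i < N + d, G.Adj (f i) (f (i + 1)) := by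
    intro i hi
    show G.Adj (if i ≤ N then η.downSeq z i else g (i - N))
      (if i + 1 ≤ N then η.downSeq z (i + 1) else g (i + 1 - N))
    rcases lt_trichotomy i N with hiN | rfl | hiN
    · rw [if_pos hiN.le, if_pos (by omega)]
      exact η.downSeq_adj z i
    · rw [if_pos le_rfl, if_neg (by omega), ← hv, ← hg0, Nat.add_sub_cancel_left]
      exact hg 0 (by omega)
    · rw [if_neg (by omega), if_neg (by omega), show i + 1 - N = (i - N) + 1 by omega]
      exact hg (i - N) (by omega)
  -- heights along the walk
  have hz0 : η.height z ≠ 0 := η.height_ne_zero hconn z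
  have hzT : η.height z ≠ ⊤ := η.height_ne_top hconn z
  have hgle : ∀ i ≤ d, η.height (g i) ≤ η.ratio ^ (N - i) * η.height z := by
    intro i hi
    have h1 := η.height_mul_ratio_pow_le hg i hi
    rw [hg0, hv, η.height_downSeq] at h1
    -- `h(g i) Δ^i ≤ Δ^N h(z) = (Δ^{N-i} h(z)) Δ^i`
    have hpow : η.ratio ^ N = η.ratio ^ (N - i) * η.ratio ^ i := by
      rw [← pow_add, Nat.sub_add_cancel (by omega)]
    have h2 : η.height (g i) * η.ratio ^ i ≤ (η.ratio ^ (N - i) * η.height z) * η.ratio ^ i := by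
      calc η.height (g i) * η.ratio ^ i ≤ η.ratio ^ N * η.height z := h1
        _ = (η.ratio ^ (N - i) * η.height z) * η.ratio ^ i := by rw [hpow]; ring
    exact (ENNReal.mul_le_mul_iff_left (η.ratio_pow_ne_zero i) (η.ratio_pow_ne_top i)).1 h2
  have hle : ∀ i ≤ N + d, η.height (f i) ≤ η.height z := by
    intro i hi
    show η.height (if i ≤ N then η.downSeq z i else g (i - N)) ≤ η.height z
    by_cases hiN : i ≤ N
    · rw [if_pos hiN, η.height_downSeq]
      calc η.ratio ^ i * η.height z ≤ 1 * η.height z := by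
            gcongr; exact pow_le_one' η.ratio_lt_one.le i
        _ = η.height z := one_mul _
    · rw [if_neg hiN]
      calc η.height (g (i - N)) ≤ η.ratio ^ (N - (i - N)) * η.height z := hgle (i - N) (by omega)
        _ ≤ 1 * η.height z := by gcongr; exact pow_le_one' η.ratio_lt_one.le _
        _ = η.height z := one_mul _
  have htz : η.height t < η.height z := by
    rw [← hgd]
    calc η.height (g d) ≤ η.ratio ^ (N - d) * η.height z := hgle d le_rfl
      _ < 1 * η.height z := by
          rw [mul_comm (η.ratio ^ (N - d)), mul_comm (1 : ℝ≥0∞)]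
          exact ENNReal.mul_lt_mul_right hz0 hzT (pow_lt_one' η.ratio_lt_one (by omega))
      _ = η.height z := one_mul _
  exact η.uppermostEvent_ne_zero_of_walk hconn hp0 hp1 hf0 hfm hfadj hle htz htpos

end Toppable

/-- **`q > 0`** ("By insertion and deletion tolerance and the assumption that there are light
clusters, we have `q := P[F] > 0`"), quasi-transitive form: on a connected, locally finite,
quasi-transitive graph with a height system, under Bernoulli(`p`) bond percolation with
`0 < p < 1`, if with positive probability some open cluster is infinite and light, then
`P[F(o)] > 0` for the mate `o'` (a neighbour of `o` of height `Δ`): an uppermost vertex of an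
infinite light cluster exists (`exists_uppermost`), the uppermost event is then positive at `o'`
(`uppermostEvent_ne_zero_of_isQuasiTransitive`, replacing the transitive transport), and
deletion of the edges at `o` followed by insertion of `{o, o'}` produces `F(o)`
(`openEdges_closeEdges_mem_niceEvent`). [cite: Timar2006, §4 (proof of Thm. 4.3: q := P[F] > 0)] -/
theorem niceEvent_pos_of_lightCluster [Countable V] (hconn : G.Connected) (hqt : IsQuasiTransitive G)
    {o' : V} (hoo' : G.Adj o o') (ho' : η.height o' = η.ratio) {p : unitInterval}
    (hp0 : 0 < (p : ℝ)) (hp1 : (p : ℝ) < 1)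
    (hpos : bondPercolation G p
      {ω | ∃ x : V, (openCluster ω x).Infinite ∧ ¬ IsHeavy G o (openCluster ω x)} ≠ 0) :
    0 < bondPercolation G p (η.niceEvent o o') := by
  set μ := bondPercolation G p with hμ
  -- some uppermost event has positive probability
  have hsub : {ω : BondConfig V | ∃ x : V, (openCluster ω x).Infinite ∧
      ¬ IsHeavy G o (openCluster ω x)} ⊆ ⋃ t : V, η.uppermostEvent t := by
    rintro ω ⟨x, hinf, hlight⟩
    obtain ⟨t, ht⟩ := η.exists_uppermost hconn hinf hlight
    exact Set.mem_iUnion.2 ⟨t, ht⟩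
  have hU' : μ (⋃ t : V, η.uppermostEvent t) ≠ 0 := fun h => hpos (measure_mono_null hsub h)
  obtain ⟨t, ht⟩ : ∃ t : V, μ (η.uppermostEvent t) ≠ 0 := by
    by_contra h
    push Not at h
    exact hU' ((measure_iUnion_null_iff).2 h)
  -- carry it to `o'` (toppability)
  have ho'pos : μ (η.uppermostEvent o') ≠ 0 :=
    η.uppermostEvent_ne_zero_of_isQuasiTransitive hconn hqt hp0 hp1 ht o'
  -- surgery: delete the edges at `o`, insert `{o, o'}`
  have hωE : ∀ᵐ ω ∂μ, ω ⊆ G.edgeSet := ProbabilityTheory.setBernoulli_ae_subset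
  set A : Set (BondConfig V) := η.uppermostEvent o' ∩ {ω | ω ⊆ G.edgeSet} with hA
  have hAeq : μ A = μ (η.uppermostEvent o') := by
    refine measure_congr ?_
    filter_upwards [hωE] with ω hω
    exact propext ⟨fun h => h.1, fun h => ⟨h, hω⟩⟩
  have hApos : 0 < μ.real A := by
    rw [measureReal_def, ENNReal.toReal_pos_iff, hAeq]
    exact ⟨pos_iff_ne_zero.2 ho'pos, measure_lt_top μ _⟩
  classical
  set F₁ : Finset (Sym2 V) := G.incidenceFinset o
  have hF₁ : ∀ e : Sym2 V, e ∈ F₁ ↔ e ∈ G.edgeSet ∧ o ∈ e := fun e =>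
    SimpleGraph.mem_incidenceFinset (G := G) (v := o) (e := e)
  set F₂ : Finset (Sym2 V) := {s(o, o')}
  set E : Set (BondConfig V) := openEdges ↑F₂ ⁻¹' η.niceEvent o o' with hEdef
  have hEm : MeasurableSet E := measurable_openEdges _ (η.measurableSet_niceEvent o o')
  have hE : 0 < μ.real E := by
    refine bondPercolation_real_pos_of_closeEdges G hp1 F₁ hEm hApos fun ω hω => ?_
    exact η.openEdges_closeEdges_mem_niceEvent hconn hoo' ho' F₁ hF₁ hω.2 hω.1
  have hF₂ : (↑F₂ : Set (Sym2 V)) ⊆ G.edgeSet := by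
    intro e he
    rw [Finset.coe_singleton, Set.mem_singleton_iff] at he
    rw [he]; exact hoo'
  have hnice := bondPercolation_real_pos_of_openEdges G hp0 F₂ hF₂ (η.measurableSet_niceEvent o o')
    hE fun ω hω => hω
  rw [measureReal_def, ENNReal.toReal_pos_iff] at hnice
  exact hnice.1

/-! ### The choice of `r`: a light cluster meets `{w ≥ B}` inside a large ball -/

/-- The event "`C(x) ∩ {w ≥ B} ⊆ B(x, r)`". [cite: Timar2006, §4 (proof of Thm. 4.3: "the probability that it intersects a large sphere around o can be made arbitrarily small")] -/
def containedEvent (η : HeightSystem G o) (x : V) (B : ℝ≥0∞) (r : ℕ) : Set (BondConfig V) :=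
  {ω | openCluster ω x ∩ {v | B ≤ η.height v} ⊆ ballSet G x r}

/-- The containment event is measurable. [folklore] -/
theorem measurableSet_containedEvent [Countable V] (x : V) (B : ℝ≥0∞) (r : ℕ) :
    MeasurableSet (η.containedEvent x B r) := by
  have : η.containedEvent x B r =
      ⋂ v ∈ {v : V | B ≤ η.height v ∧ v ∉ ballSet G x r}, {ω | v ∈ openCluster ω x}ᶜ := by
    ext ω
    simp only [containedEvent, Set.subset_def, Set.mem_inter_iff, Set.mem_setOf_eq, Set.mem_iInter,
      Set.mem_compl_iff]
    constructor
    · rintro h v ⟨hvB, hvball⟩ hvC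
      exact hvball (h v ⟨hvC, hvB⟩)
    · rintro h v ⟨hvC, hvB⟩
      by_contra hvball
      exact h v ⟨hvB, hvball⟩ hvC
  rw [this]
  exact MeasurableSet.biInter (Set.to_countable _) fun v _ => (measurableSet_mem_openCluster x v).compl

/-- The containment events grow with the radius. [folklore] -/
theorem containedEvent_mono (x : V) (B : ℝ≥0∞) {r s : ℕ} (h : r ≤ s) :
    η.containedEvent x B r ⊆ η.containedEvent x B s :=
  fun _ hω => hω.trans (ballSet_mono x h)

/-- A light cluster is eventually contained: for `B ≠ 0`, `⋂_r ({light} ∖ containedEvent r) = ∅`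
(the finitely many vertices of `C(x)` of weight `≥ B` lie in some ball). [cite: Timar2006, §4 (proof of Thm. 4.3: "the intersection of a light cluster with G(ℓ_{j+i}, ℓ_j] is finite by definition")] -/
theorem iInter_light_diff_containedEvent (hconn : G.Connected) (x : V) {B : ℝ≥0∞} (hB : B ≠ 0) :
    ⋂ r : ℕ, ({ω : BondConfig V | ¬ IsHeavy G o (openCluster ω x)} \ η.containedEvent x B r) = ∅ := by
  refine Set.eq_empty_of_forall_notMem fun ω hω => ?_
  rw [Set.mem_iInter] at hω
  have hlight := (hω 0).1
  have hfin := η.finite_inter_height_of_not_isHeavy hlight hB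
  -- each of the finitely many vertices lies in some ball, eventually in all balls
  have hev : ∀ᶠ r : ℕ in atTop, ∀ v ∈ openCluster ω x ∩ {v | B ≤ η.height v},
      v ∈ ballSet G x r := by
    rw [hfin.eventually_all]
    intro v _
    obtain ⟨p⟩ := hconn.preconnected x v
    exact eventually_atTop.2 ⟨p.length, fun r hr => mem_ballSet_iff.2 ⟨p, hr⟩⟩
  obtain ⟨r, hr⟩ := hev.exists
  exact (hω r).2 hr

/-- Hence **`P[light, not contained in B(x, r)] → 0`** as `r → ∞`. [cite: Timar2006, §4 (proof of Thm. 4.3: choice of r)] -/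
theorem tendsto_measure_light_diff_containedEvent [Countable V] (hconn : G.Connected) (x : V)
    {B : ℝ≥0∞} (hB : B ≠ 0) (μ : Measure (BondConfig V)) [IsFiniteMeasure μ] :
    Tendsto (fun r : ℕ => μ ({ω | ¬ IsHeavy G o (openCluster ω x)} \ η.containedEvent x B r))
      atTop (𝓝 0) := by
  have hmeas : ∀ r : ℕ, NullMeasurableSet
      ({ω : BondConfig V | ¬ IsHeavy G o (openCluster ω x)} \ η.containedEvent x B r) μ :=
    fun r => ((measurableSet_isHeavy_openCluster G o x).compl.diff
      (η.measurableSet_containedEvent x B r)).nullMeasurableSet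
  have hanti : Antitone fun r : ℕ =>
      {ω : BondConfig V | ¬ IsHeavy G o (openCluster ω x)} \ η.containedEvent x B r :=
    fun r s hrs ω hω => ⟨hω.1, fun h => hω.2 (η.containedEvent_mono x B hrs h)⟩
  have h := tendsto_measure_iInter_atTop hmeas hanti ⟨0, measure_ne_top μ _⟩
  rwa [η.iInter_light_diff_containedEvent hconn x hB, measure_empty] at h

/-! ### The uniform choice of `i` and `r` -/

/-- **"For any `k`, there exist an `i` and an `r ∈ ℕ` such that the open component of `o` in
`B_o(i; r)` is good with probability `> q/2` … Clearly, there is also a uniform choice"**, PROVED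
in the form: for every `k`, for all sufficiently large depths `I` and then all sufficiently large
radii `r`, `P[F(o)] ≤ 2 · P[η.boxGood o o' a r k]` for EVERY threshold `a ∈ [Δ^{I+1}, Δ^I)` (the
relative thresholds met along the branching process), under Bernoulli(`p`) bond percolation with
`p < 1` on a connected, locally finite, quasi-transitive graph with a height system, `o'` a
neighbour of `o` of height `Δ`. (The "eventually" form — rather than "there exist `I` and `r`" —
is what allows one common choice for the finitely many orbit representatives.)
[cite: Timar2006, §4 (proof of Thm. 4.3: choice of i and r; "Clearly, there is also a uniform choice")] -/
theorem eventually_depth_radius_boxGood_ge [Countable V] (hconn : G.Connected)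
    (hqt : IsQuasiTransitive G) {o' : V}
    (ho' : η.height o' = η.ratio) {p : unitInterval} (hp1 : (p : ℝ) < 1) (k : ℕ) :
    ∀ᶠ I : ℕ in atTop, ∀ᶠ r : ℕ in atTop, ∀ a : ℝ≥0∞, η.ratio ^ (I + 1) ≤ a →
      a < η.ratio ^ I →
        bondPercolation G p (η.niceEvent o o') ≤
          2 * bondPercolation G p (η.boxGood o o' a r k) := by
  set μ := bondPercolation G p with hμ
  set Δ := η.ratio with hΔ
  have hΔ0 : Δ ≠ 0 := η.ratio_ne_zero
  have hΔ1 : Δ < 1 := η.ratio_lt_one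
  obtain ⟨D, hD⟩ := hqt.exists_degree_le
  set q := μ (η.niceEvent o o') with hq
  by_cases hq0 : q = 0
  · refine Filter.Eventually.of_forall fun I => Filter.Eventually.of_forall fun r a _ _ => ?_
    rw [hq0]; exact zero_le
  -- `ε = q/4`
  set ε := q / 2 / 2 with hε
  have hqT : q ≠ ⊤ := measure_ne_top μ _
  have hε0 : 0 < ε := by
    rw [hε]
    exact ENNReal.div_pos (ENNReal.div_pos hq0 ENNReal.ofNat_ne_top).ne' ENNReal.ofNat_ne_top
  -- depth from the uniform Lemma 4.2
  obtain ⟨A₀, hA₀, hfew⟩ := η.exists_forall_measure_windowFewEvent_le hconn hD hp1 k hε0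
  have hevI : ∀ᶠ n : ℕ in atTop, Δ ^ n < A₀ :=
    (tendsto_order.1 ((ENNReal.tendsto_pow_atTop_nhds_zero_iff).2 hΔ1)).2 A₀ hA₀
  filter_upwards [hevI] with I hIA
  -- radius from the containment of light clusters
  set B := Δ ^ (I + 1) with hB
  have hB0 : B ≠ 0 := pow_ne_zero _ hΔ0
  have htend := η.tendsto_measure_light_diff_containedEvent (o := o) hconn o hB0 μ
  obtain ⟨N, hN⟩ := (ENNReal.tendsto_atTop_zero.1 htend) ε hε0
  filter_upwards [eventually_ge_atTop N] with r hr
  intro a haB haI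
  have ha0 : 0 < a := lt_of_lt_of_le (pos_iff_ne_zero.2 hB0) haB
  have haA₀ : a ≤ A₀ := (haI.trans hIA).le
  have ha1 : a < η.height o := by
    rw [η.height_base hconn]
    exact lt_of_lt_of_le haI (pow_le_one' hΔ1.le I)
  have ho'low : o' ∈ η.lowSet o := by
    show η.height o' ≤ η.ratio * η.height o
    rw [η.height_base hconn, mul_one, ho']
  -- the inclusion `F ∩ (few)ᶜ ∩ contained ⊆ good`, almost surely
  have hωE : ∀ᵐ ω ∂μ, ω ⊆ G.edgeSet := ProbabilityTheory.setBernoulli_ae_subset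
  have hincl : μ (η.niceEvent o o' ∩ (η.windowFewEvent a k)ᶜ ∩ η.containedEvent o B r) ≤
      μ (η.boxGood o o' a r k) := by
    refine measure_mono_ae ?_
    filter_upwards [hωE] with ω hω hmem
    obtain ⟨⟨⟨hinf, hlight, hnice⟩, hnotfew⟩, hcont⟩ := hmem
    refine η.boxGood_of_nice hconn ho'low ha1 hω hnice ?_ ?_
    · intro v hv
      exact hcont ⟨hv.1, le_of_lt (lt_of_le_of_lt haB hv.2)⟩
    · have : ¬ (η.wregionCluster a ω ∩ η.wwindow a).encard < k := fun h =>
        hnotfew ⟨hinf, hlight, h⟩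
      exact not_lt.1 this
  -- `q ≤ P[good] + ε + ε`
  have hsplit : q ≤ μ (η.boxGood o o' a r k) + ε + ε := by
    have hsub : η.niceEvent o o' ⊆
        (η.niceEvent o o' ∩ (η.windowFewEvent a k)ᶜ ∩ η.containedEvent o B r) ∪
          η.windowFewEvent a k ∪
          ({ω | ¬ IsHeavy G o (openCluster ω o)} \ η.containedEvent o B r) := by
      intro ω hω
      by_cases h1 : ω ∈ η.windowFewEvent a k
      · exact Or.inl (Or.inr h1)
      by_cases h2 : ω ∈ η.containedEvent o B r
      · exact Or.inl (Or.inl ⟨⟨hω, h1⟩, h2⟩)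
      · exact Or.inr ⟨hω.2.1, h2⟩
    calc q ≤ μ _ := measure_mono hsub
      _ ≤ μ (η.niceEvent o o' ∩ (η.windowFewEvent a k)ᶜ ∩ η.containedEvent o B r) +
            μ (η.windowFewEvent a k) +
            μ ({ω | ¬ IsHeavy G o (openCluster ω o)} \ η.containedEvent o B r) :=
          (measure_union_le _ _).trans (by gcongr; exact measure_union_le _ _)
      _ ≤ μ (η.boxGood o o' a r k) + ε + ε := by
          gcongr
          · exact hfew a ha0 haA₀
          · exact hN r hr
  -- conclude `q ≤ 2 P[good]`
  have hεε : ε + ε = q / 2 := ENNReal.add_halves (q / 2)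
  have hq2 : q / 2 + q / 2 = q := ENNReal.add_halves q
  rw [add_assoc, hεε] at hsplit
  have hq2T : q / 2 ≠ ⊤ := ENNReal.div_ne_top hqT two_ne_zero
  have hhalf : q / 2 ≤ μ (η.boxGood o o' a r k) :=
    (ENNReal.add_le_add_iff_right hq2T).1 (hq2.le.trans hsplit)
  calc q = q / 2 + q / 2 := hq2.symm
    _ ≤ μ (η.boxGood o o' a r k) + μ (η.boxGood o o' a r k) := add_le_add hhalf hhalf
    _ = 2 * μ (η.boxGood o o' a r k) := (two_mul _).symm

end Nice

end HeightSystem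

end Literature.Barriers.CriticalPhenomena

end
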